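import Mathlib
import Summits.NavierStokesRegularity.NavierStokesRegularity.Theorems.EulerZoomLiouvillePowerGaugeEulerLiouvilleNeedleRace
import Summits.NavierStokesRegularity.NavierStokesRegularity.Theorems.EulerZoomLiouvillePowerGaugeEulerLiouvilleNeedleThinCoreMember
import Summits.NavierStokesRegularity.NavierStokesRegularity.Theorems.EulerZoomLiouvillePowerGaugeEulerLiouvilleSelfSimilarBernoulliPiercing
import Literature.Analysis.FluidPDE.ElgindiBlowup
import HarnessLib.Audit

/-!
# Crux E `EulerZoomLiouville.PowerGaugeEulerLiouville` — the needle stratum: THE FEEDING-TIME RACE AT MEMBER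
# LEVEL (ROUND-37 (S37) modulo (K)): an exactly self-similar member with an axisymmetric swirl-free `C²`
# profile and super-polynomially thin fast exits is trivial

Route №10 `EulerZoomLiouville` (NavierStokesRegularity), crux E = stmt-NavierStokesRegularity-19832,
registered residue `stub_selfSimilarC2Needle`, memo ROUND-37 of the cell `ns-regularity-ideate`
(text custody nsreg-p2).  Member corollary of the race `NeedleRace.curl_eq_zero_of_thinFastExits`:

* `lintegral_fderiv_sq_closedBall_le` / `lintegral_fderiv_sq_ball_le` / `integral_curl_sq_closedBall_le` —
  GRADIENT and ENSTROPHY GROWTH of a profile from the `E`-weight: `∫⁻ ‖DV‖² ‖y‖^{ρ−1} ≤ E` gives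
  `∫⁻_{B_L} ‖DV‖² ≤ E L^{1−ρ}` and `∫_{B̄_L} ‖curl V‖² ≤ 16 E L^{1−ρ}` for `L ≥ 1`
  (`‖y‖^{ρ−1} ≥ L^{ρ−1}` on the punctured ball, `‖curl‖ ≤ 4‖DV‖`) — the ball form is the `E`-budget
  hypothesis of ROUND-37 (K) part C (nsreg-p2 t38j), the class value being `E = (1−ρ)/(2+ρ)·c`
  (`NeedleThinCore.selfSimilar_needle_inputs`);
* **`selfSimilar_ae_eq_zero_of_axisymNoSwirl_thinFastExits`** — crux hypotheses verbatim (`0 < ρ ≤ ½`: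
  suitable weak Euler pair on `(−∞,0) × ℝ³`, weak spatial gradient `H`, power gauges
  `a^{2ρ}A + a^{ρ}E + a^{2ρ}D ≤ c`) + exact self-similarity with profile `(V, P)` + `V ∈ C²` AXISYMMETRIC
  and SWIRL-FREE + SUPER-POLYNOMIALLY THIN FAST EXITS of `V` at exponent `γ = 1/(2+ρ)` (the conclusion of
  ROUND-37's Lemma K with the log-capacity thinness of ROUND-36, kept as the ONE hypothesis `hthin` until
  nsreg-p2's plates t38h/t38i land) ⇒ `u = 0` a.e. on the slab.  Chain: classical pressure
  (`WeakToClassical.exists_isSelfSimilarEulerProfile_of_contDiff`), `E`-weight of the profile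
  (`NeedleThinCore.selfSimilar_needle_inputs`), the race ⇒ `curl V ≡ 0`, the irrotational stratum
  (`Loc.selfSimilar_ae_eq_zero_of_irrotationalC2_profile`).

NOT NS, not E, not the general needle: a model-class stratum (LEAD RESIDUE-MEMO-19832-g11 §2 D2) of THE ONE
STATEMENT, conditional on `hthin`; 19832 OPEN.  References: Constantin–Ignatova–Vicol arXiv:2602.17570
§3.4–§3.5 [ConstantinIgnatovaVicol2026Putative]; KNSS 2009 Remark 5.1 [KochNadirashviliSereginSverak2009].
-/

noncomputable section

-- the summit and its single problem share the name `NavierStokesRegularity` (D-0017 nested layout)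
set_option linter.dupNamespace false

open Set Filter Topology Metric Function MeasureTheory InnerProductSpace
open scoped RealInnerProductSpace NNReal ENNReal

namespace Summit.NavierStokesRegularity.NavierStokesRegularity.Theorems.PowerGaugeEulerLiouville.NeedleRace

open Literature.Analysis Literature.Analysis.FluidPDE
open Summit.NavierStokesRegularity.NavierStokesRegularity.Theorems.PowerGaugeEulerLiouville

variable {V : EuclideanSpace ℝ (Fin 3) → EuclideanSpace ℝ (Fin 3)}

/-! ### Gradient and enstrophy growth from the `E`-weight -/

/-- **Gradient growth on balls from the `E`-weight**: if `∫⁻ ‖DV(y)‖² ‖y‖^{ρ−1} dy ≤ E` (`ρ < 1`, `E ≥ 0`) then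
`∫⁻_{B̄_L} ‖DV‖² ≤ E · L^{1−ρ}` for every `L ≥ 1` (`‖y‖^{ρ−1} ≥ L^{ρ−1}` on the punctured ball). [folklore] -/
theorem lintegral_fderiv_sq_closedBall_le {ρ : ℝ} (hρ1 : ρ < 1) {E : ℝ} (hE0 : 0 ≤ E)
    (hE : ∫⁻ y, ‖fderiv ℝ V y‖ₑ ^ 2 * ENNReal.ofReal (‖y‖ ^ (ρ - 1)) ≤ ENNReal.ofReal E)
    {L : ℝ} (hL : 1 ≤ L) :
    ∫⁻ z in closedBall (0 : EuclideanSpace ℝ (Fin 3)) L, ‖fderiv ℝ V z‖ₑ ^ 2 ≤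
      ENNReal.ofReal (E * L ^ (1 - ρ)) := by
  have hL0 : 0 < L := by linarith
  -- pointwise, off the origin: `‖DV‖ₑ² ≤ ‖DV‖ₑ² · ‖z‖^{ρ−1} · L^{1−ρ}`
  have hpt : ∀ᵐ z ∂(volume.restrict (closedBall (0 : EuclideanSpace ℝ (Fin 3)) L)),
      ‖fderiv ℝ V z‖ₑ ^ 2 ≤
        ‖fderiv ℝ V z‖ₑ ^ 2 * ENNReal.ofReal (‖z‖ ^ (ρ - 1)) * ENNReal.ofReal (L ^ (1 - ρ)) := by
    have h0 : ({0}ᶜ : Set (EuclideanSpace ℝ (Fin 3))) ∈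
        ae (volume.restrict (closedBall (0 : EuclideanSpace ℝ (Fin 3)) L)) :=
      ae_restrict_of_ae (compl_mem_ae_iff.2 (measure_singleton 0))
    filter_upwards [h0, ae_restrict_mem measurableSet_closedBall] with z hz hzL
    have hz0 : 0 < ‖z‖ := norm_pos_iff.2 hz
    have hzL' : ‖z‖ ≤ L := mem_closedBall_zero_iff.1 hzL
    -- `1 ≤ ‖z‖^{ρ−1} L^{1−ρ}`
    have h2 : 1 ≤ ‖z‖ ^ (ρ - 1) * L ^ (1 - ρ) := by
      have h21 : L ^ (ρ - 1) ≤ ‖z‖ ^ (ρ - 1) :=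
        Real.rpow_le_rpow_of_nonpos hz0 hzL' (by linarith)
      have h22 : L ^ (ρ - 1) * L ^ (1 - ρ) = 1 := by
        rw [← Real.rpow_add hL0, show ρ - 1 + (1 - ρ) = 0 by ring, Real.rpow_zero]
      have h23 : 0 ≤ L ^ (1 - ρ) := Real.rpow_nonneg hL0.le _
      nlinarith
    have h3 : (1 : ℝ≥0∞) ≤ ENNReal.ofReal (‖z‖ ^ (ρ - 1)) * ENNReal.ofReal (L ^ (1 - ρ)) := by
      rw [← ENNReal.ofReal_mul (Real.rpow_nonneg (norm_nonneg _) _), ← ENNReal.ofReal_one]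
      exact ENNReal.ofReal_le_ofReal h2
    calc ‖fderiv ℝ V z‖ₑ ^ 2 = ‖fderiv ℝ V z‖ₑ ^ 2 * 1 := (mul_one _).symm
      _ ≤ ‖fderiv ℝ V z‖ₑ ^ 2 * (ENNReal.ofReal (‖z‖ ^ (ρ - 1)) * ENNReal.ofReal (L ^ (1 - ρ))) :=
          mul_le_mul' le_rfl h3
      _ = _ := by rw [mul_assoc]
  calc ∫⁻ z in closedBall (0 : EuclideanSpace ℝ (Fin 3)) L, ‖fderiv ℝ V z‖ₑ ^ 2
      ≤ ∫⁻ z in closedBall (0 : EuclideanSpace ℝ (Fin 3)) L,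
          ‖fderiv ℝ V z‖ₑ ^ 2 * ENNReal.ofReal (‖z‖ ^ (ρ - 1)) * ENNReal.ofReal (L ^ (1 - ρ)) :=
        lintegral_mono_ae hpt
    _ = (∫⁻ z in closedBall (0 : EuclideanSpace ℝ (Fin 3)) L,
          ‖fderiv ℝ V z‖ₑ ^ 2 * ENNReal.ofReal (‖z‖ ^ (ρ - 1))) * ENNReal.ofReal (L ^ (1 - ρ)) := by
        rw [lintegral_mul_const' _ _ ENNReal.ofReal_ne_top]
    _ ≤ (∫⁻ z, ‖fderiv ℝ V z‖ₑ ^ 2 * ENNReal.ofReal (‖z‖ ^ (ρ - 1))) * ENNReal.ofReal (L ^ (1 - ρ)) := by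
        gcongr
        exact Measure.restrict_le_self
    _ ≤ ENNReal.ofReal E * ENNReal.ofReal (L ^ (1 - ρ)) := by gcongr
    _ = ENNReal.ofReal (E * L ^ (1 - ρ)) := (ENNReal.ofReal_mul hE0).symm

/-- The same on OPEN balls (the shape of ROUND-37 (K), t38j part C's `E`-budget hypothesis):
`∫⁻_{B_L} ‖DV‖² ≤ E · L^{1−ρ}` for `L ≥ 1`. [folklore] -/
theorem lintegral_fderiv_sq_ball_le {ρ : ℝ} (hρ1 : ρ < 1) {E : ℝ} (hE0 : 0 ≤ E)
    (hE : ∫⁻ y, ‖fderiv ℝ V y‖ₑ ^ 2 * ENNReal.ofReal (‖y‖ ^ (ρ - 1)) ≤ ENNReal.ofReal E)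
    {L : ℝ} (hL : 1 ≤ L) :
    ∫⁻ z in ball (0 : EuclideanSpace ℝ (Fin 3)) L, ‖fderiv ℝ V z‖ₑ ^ 2 ≤ ENNReal.ofReal (E * L ^ (1 - ρ)) :=
  (lintegral_mono_set ball_subset_closedBall).trans (lintegral_fderiv_sq_closedBall_le hρ1 hE0 hE hL)

/-- **Enstrophy growth of a `C²` profile from the `E`-weight**: if `∫⁻ ‖DV(y)‖² ‖y‖^{ρ−1} dy ≤ E` (`ρ < 1`)
then `∫_{B̄_L} ‖curl V‖² ≤ 16 E L^{1−ρ}` for every `L ≥ 1` (`‖curl‖ ≤ 4‖DV‖`). [folklore] -/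
theorem integral_curl_sq_closedBall_le {ρ : ℝ} (hρ1 : ρ < 1) (hV : ContDiff ℝ 2 V) {E : ℝ} (hE0 : 0 ≤ E)
    (hE : ∫⁻ y, ‖fderiv ℝ V y‖ₑ ^ 2 * ENNReal.ofReal (‖y‖ ^ (ρ - 1)) ≤ ENNReal.ofReal E)
    {L : ℝ} (hL : 1 ≤ L) :
    ∫ z in closedBall (0 : EuclideanSpace ℝ (Fin 3)) L, ‖curl V z‖ ^ 2 ≤ 16 * E * L ^ (1 - ρ) := by
  have hL0 : 0 < L := by linarith
  have hcont : Continuous fun z => ‖curl V z‖ ^ 2 :=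
    ((differentiable_curl_of_contDiff hV).continuous.norm).pow 2
  have hint : IntegrableOn (fun z => ‖curl V z‖ ^ 2) (closedBall (0 : EuclideanSpace ℝ (Fin 3)) L) :=
    hcont.continuousOn.integrableOn_compact (isCompact_closedBall 0 L)
  rw [integral_eq_lintegral_of_nonneg_ae (Eventually.of_forall fun z => sq_nonneg _)
    hint.aestronglyMeasurable]
  apply ENNReal.toReal_le_of_le_ofReal (by positivity)
  -- pointwise: `ofReal ‖curl‖² ≤ 16 ‖DV‖ₑ²`
  have hpt : ∀ z : EuclideanSpace ℝ (Fin 3),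
      ENNReal.ofReal (‖curl V z‖ ^ 2) ≤ ENNReal.ofReal 16 * ‖fderiv ℝ V z‖ₑ ^ 2 := by
    intro z
    have h1 : ‖curl V z‖ ^ 2 ≤ 16 * ‖fderiv ℝ V z‖ ^ 2 := by
      have h := norm_curl_le_four_mul V z
      have h' : 0 ≤ ‖curl V z‖ := norm_nonneg _
      nlinarith
    have h3 : ‖fderiv ℝ V z‖ₑ ^ 2 = ENNReal.ofReal (‖fderiv ℝ V z‖ ^ 2) := by
      rw [← ofReal_norm, ENNReal.ofReal_pow (norm_nonneg _)]
    rw [h3, ← ENNReal.ofReal_mul (by norm_num)]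
    exact ENNReal.ofReal_le_ofReal h1
  calc ∫⁻ z in closedBall (0 : EuclideanSpace ℝ (Fin 3)) L, ENNReal.ofReal (‖curl V z‖ ^ 2)
      ≤ ∫⁻ z in closedBall (0 : EuclideanSpace ℝ (Fin 3)) L, ENNReal.ofReal 16 * ‖fderiv ℝ V z‖ₑ ^ 2 :=
        lintegral_mono fun z => hpt z
    _ = ENNReal.ofReal 16 * ∫⁻ z in closedBall (0 : EuclideanSpace ℝ (Fin 3)) L, ‖fderiv ℝ V z‖ₑ ^ 2 := by
        rw [lintegral_const_mul' _ _ ENNReal.ofReal_ne_top]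
    _ ≤ ENNReal.ofReal 16 * ENNReal.ofReal (E * L ^ (1 - ρ)) := by
        gcongr
        exact lintegral_fderiv_sq_closedBall_le hρ1 hE0 hE hL
    _ = ENNReal.ofReal (16 * E * L ^ (1 - ρ)) := by
        rw [← ENNReal.ofReal_mul (by norm_num), mul_assoc]

/-! ### Member level -/

/-- **MEMBER LEVEL — ROUND-37 (S37) modulo Lemma K.**  An exactly self-similar member of Seregin's power-gauged
ancient Euler class (`0 < ρ ≤ ½`, crux hypotheses verbatim) whose velocity profile `V` is `C²`, AXISYMMETRIC and
SWIRL-FREE, and has SUPER-POLYNOMIALLY THIN FAST EXITS at the class exponent `γ = 1/(2+ρ)` (for some `κ > 0` and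
every `m`: for all large `R` a measurable set `G ⊆ [R², 4R²]` of good squared radii with `|G| ≥ κR²` and a
measurable tube `N ⊆ B̄_{2R}` containing every strictly γ-fast point `⟪V z, z⟫ < −γ‖z‖²` with `‖z‖² ∈ G`, such
that `|N| · ∫_N ‖V‖² ≤ R^{−m}`), is trivial: `u = 0` a.e. on `(−∞,0) × ℝ³`.
[cite: ConstantinIgnatovaVicol2026Putative, §3.4.1 eq. (3.21)-(3.22), §3.5] -/
theorem selfSimilar_ae_eq_zero_of_axisymNoSwirl_thinFastExits {ρ : ℝ} (hρ : 0 < ρ) (hρ1 : ρ ≤ 1 / 2)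
    {u : ℝ → EuclideanSpace ℝ (Fin 3) → EuclideanSpace ℝ (Fin 3)} {p : ℝ → EuclideanSpace ℝ (Fin 3) → ℝ}
    {H : ℝ → EuclideanSpace ℝ (Fin 3) → EuclideanSpace ℝ (Fin 3) →L[ℝ] EuclideanSpace ℝ (Fin 3)} {c : ℝ≥0}
    (hsw : IsSuitableWeakSolutionOn (slab (EuclideanSpace ℝ (Fin 3)) (Iio 0) isOpen_Iio) 0 0 u p)
    (hH : HasWeakSpatialGradientOn (slab (EuclideanSpace ℝ (Fin 3)) (Iio 0) isOpen_Iio) u H)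
    (hgauge : ∀ a : ℝ, 0 < a →
      ENNReal.ofReal (a ^ (2 * ρ)) * cknA a (0 : ℝ × EuclideanSpace ℝ (Fin 3)) u +
          ENNReal.ofReal (a ^ ρ) * cknE a (0 : ℝ × EuclideanSpace ℝ (Fin 3)) H +
        ENNReal.ofReal (a ^ (2 * ρ)) * cknD a (0 : ℝ × EuclideanSpace ℝ (Fin 3)) p ≤ (c : ℝ≥0∞))
    {P : EuclideanSpace ℝ (Fin 3) → ℝ}
    (hu : ∀ τ : ℝ, τ < 0 → u τ = selfSimilarCollapse (1 / (2 + ρ)) 0 V τ)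
    (hp : ∀ τ : ℝ, τ < 0 → p τ = selfSimilarCollapsePressure (1 / (2 + ρ)) 0 P τ)
    (hV : ContDiff ℝ 2 V) (hax : IsAxisymmetric V) (hns : HasNoSwirl V)
    {κ : ℝ} (hκ : 0 < κ)
    (hthin : ∀ m : ℝ, ∃ R₀ : ℝ, ∀ R : ℝ, R₀ ≤ R →
      ∃ (G : Set ℝ) (N : Set (EuclideanSpace ℝ (Fin 3))),
        MeasurableSet G ∧ G ⊆ Icc (R ^ 2) ((2 * R) ^ 2) ∧ κ * R ^ 2 ≤ (volume G).toReal ∧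
        MeasurableSet N ∧ N ⊆ closedBall (0 : EuclideanSpace ℝ (Fin 3)) (2 * R) ∧
        (∀ z : EuclideanSpace ℝ (Fin 3), ‖z‖ ^ 2 ∈ G →
          ⟪V z, z⟫ + 1 / (2 + ρ) * ‖z‖ ^ 2 < 0 → z ∈ N) ∧
        volume N * ∫⁻ z in N, ENNReal.ofReal (‖V z‖ ^ 2) ≤ ENNReal.ofReal (R ^ (-m))) :
    uncurry u =ᵐ[volume.restrict (Iio (0 : ℝ) ×ˢ (univ : Set (EuclideanSpace ℝ (Fin 3))))] 0 := by
  -- boilerplate adapted from `Loc.selfSimilar_ae_eq_zero_of_piercingBernoulliC2_profile` (…SelfSimilarBernoulliPiercing)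
  have hρ1' : ρ < 1 := by linarith
  have h2ρ : (0 : ℝ) < 2 + ρ := by linarith
  have hγ : (0 : ℝ) < 1 / (2 + ρ) := one_div_pos.2 h2ρ
  have hγ2 : 1 / (2 + ρ) < 1 / 2 := one_div_lt_one_div_of_lt two_pos (by linarith)
  have hA : ∀ a : ℝ, 0 < a → ENNReal.ofReal (a ^ (2 * ρ)) *
      cknA a (0 : ℝ × EuclideanSpace ℝ (Fin 3)) u ≤ (c : ℝ≥0∞) :=
    fun a ha => le_trans (le_trans le_self_add le_self_add) (hgauge a ha)
  have hD : ∀ a : ℝ, 0 < a → ENNReal.ofReal (a ^ (2 * ρ)) *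
      cknD a (0 : ℝ × EuclideanSpace ℝ (Fin 3)) p ≤ (c : ℝ≥0∞) :=
    fun a ha => le_trans le_add_self (hgauge a ha)
  have hpm : AEStronglyMeasurable (uncurry p)
      (volume.restrict (Iio (0 : ℝ) ×ˢ (univ : Set (EuclideanSpace ℝ (Fin 3))))) := by
    have := hsw.distributional.2.2.1.aestronglyMeasurable
    simpa [slab] using this
  have hPm := aestronglyMeasurable_pressureProfile hpm hp
  have hDprof := profile_pressure_weight_of_gaugeD hρ hρ1' hpm hp hD
  have hP1 : LocallyIntegrable P volume :=
    EnergySaturation.locallyIntegrable_pressure_of_weight hρ1' hPm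
      (ENNReal.mul_ne_top ENNReal.ofReal_ne_top ENNReal.coe_ne_top) hDprof
  obtain ⟨P', hprof⟩ :=
    WeakToClassical.exists_isSelfSimilarEulerProfile_of_contDiff hsw.distributional hu hp hV hP1
  -- the enstrophy growth of the profile from the `E`-gauge
  obtain ⟨-, hE⟩ := NeedleThinCore.selfSimilar_needle_inputs hρ hρ1' hsw hH hgauge hu hp (hV.of_le one_le_two)
  have hE0 : 0 ≤ (1 - ρ) / (2 + ρ) * (c : ℝ) := by
    have : 0 ≤ 1 - ρ := by linarith
    positivity
  have hcurl : ∀ L : ℝ, 1 ≤ L →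
      ∫ z in closedBall (0 : EuclideanSpace ℝ (Fin 3)) L, ‖curl V z‖ ^ 2 ≤
        16 * ((1 - ρ) / (2 + ρ) * (c : ℝ)) * L ^ (1 - ρ) :=
    fun L hL => integral_curl_sq_closedBall_le hρ1' hV hE0 hE hL
  -- the race
  have hc0 : ∀ x, curl V x = 0 :=
    curl_eq_zero_of_thinFastExits hprof hγ hγ2 hax hns (q := 1 - ρ) (by linarith) hcurl hκ hthin
  exact Loc.selfSimilar_ae_eq_zero_of_irrotationalC2_profile hρ hsw.distributional hA hu hV hc0

end Summit.NavierStokesRegularity.NavierStokesRegularity.Theorems.PowerGaugeEulerLiouville.NeedleRace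

end
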